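import Literature.IUT.HodgeArakelov.LabelClassesOfCuspsCor24iLevelCore

/-!
# [IUTchII] Cor 2.4 (i), input (B): the «components are blocks» input of the per-level core, PROVED from an invariant reachability relation

S. Mochizuki, *Inter-universal Teichmüller theory II*, kurims manuscript (Dec. 2020), §2, Cor 2.4 (i), proof p. 71
l. 1–3 ("[cf. also [CombGC], Proposition 1.2, (ii)] … to the various finite index open subgroups of `Δ^±_v`")
([IUTchII] Cor 2.4 (i), kurims pp.70-71) [claim: Mochizuki2012, status: disputed] (D-0012; nothing printed is asserted).

PROOF-ONLY companion (no definitions; abc-iut cell, wave 5, seat abc-iut-w5-d132) of this seat's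
`LabelClassesOfCuspsCor24iLevelCore` (p416078): of the five per-level inputs of `PlusMinusTower.hlevel_of_levelData`,
the input `blk` («`g · □̃_i` meets `□̃_i` ⇒ `g · □̃_i ⊆ □̃_i`: distinct connected components of the inverse image of `□`
in the level-`i` dual graph are disjoint») is PURE COMBINATORICS.  It holds for `comp := {v | R c v}` — the component
of the base vertex `c` for ANY reflexive-free «reachability inside the inverse image of `□`» relation `R` that is
symmetric, transitive and preserved by the action (a graph automorphism preserving the inverse image of `□` preserves
reachability inside it) — whatever carrier the L5/L3 side chooses for the level graphs (`PSCDatum`, semi-graphs,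
`SimpleGraph`): `block_of_invariantRel` (fully generic) and `PlusMinusTower.blk_of_invariantRel` (the exact `blk`
binder).  So of the per-level inputs only `base`/`inc` ([IUTchI] Cor 2.3 (vi) at level `i`) and `stab`/`stabCl`
(the stabiliser of `□̃_i`, [CombGC] Prop 1.2 (ii) / [IUTchI] Cor 2.3 (ii)) carry anabelian content.  PROVED; typed ≠
proved for those; no side taken on [IUTchIII] Cor 3.12.
-/

namespace Literature.IUT.HodgeArakelov

universe u

/-- **IUTchII:Cor2.4(i)** (kurims p.71 l.1–3, combinatorial input) **Components are blocks.**  Let `sm : M → V → V`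
be an action on the vertices of a graph and `R` a symmetric, transitive relation on `V` («joined by a path inside
the inverse image of `□`») preserved by `sm g`.  If `g` moves SOME vertex of the component `{v | R c v}` of `c` to a
vertex of that component, it maps the WHOLE component into itself. PROVED (three steps of `R`).
[claim: Mochizuki2012, status: disputed] -/
theorem block_of_invariantRel {M : Type*} {V : Type*} (sm : M → V → V) (R : V → V → Prop)
    (hsymm : ∀ {v w}, R v w → R w v) (htrans : ∀ {v w x}, R v w → R w x → R v x)
    (g : M) (hg : ∀ {v w}, R v w → R (sm g v) (sm g w)) (c : V) :
    (∃ v ∈ {v | R c v}, sm g v ∈ {v | R c v}) → ∀ v ∈ {v | R c v}, sm g v ∈ {v | R c v} := by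
  rintro ⟨v, hv, hgv⟩ w hw
  -- `c ~ g·v` and `g·v ~ g·w` (from `v ~ w`), hence `c ~ g·w`
  exact htrans hgv (hg (htrans (hsymm hv) hw))

namespace PlusMinusTower

open Literature.IUT.HodgeTheaters

variable {S : BadPlaceSetting.{u}} {P : TopGroup.{u}} {T : TemperedCoverings S P} (W : PlusMinusTower T)

/-- **IUTchII:Cor2.4(i)** (kurims p.71 l.1–3) **The binder `blk` of `hlevel_of_levelData` from an invariant reachability
relation**: with `comp := {v | R c v}` (the component of the base vertex `c` inside the inverse image of `□` at
level `i`), `blk` holds as soon as `R` is symmetric, transitive and preserved by the action of every `g ∈ Δ^±_v`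
(graph automorphisms of `Γ_i` preserving the inverse image of `□`). PROVED. [claim: Mochizuki2012, status: disputed] -/
theorem blk_of_invariantRel {V : Type*} (sm : W.Corhat → V → V) (R : V → V → Prop) (c : V)
    (hsymm : ∀ {v w}, R v w → R w v) (htrans : ∀ {v w x}, R v w → R w x → R v x)
    (hinv : ∀ g : W.Corhat, g ∈ W.piPM ⊓ W.aug.ker → ∀ {v w}, R v w → R (sm g v) (sm g w)) :
    ∀ g : W.Corhat, g ∈ W.piPM ⊓ W.aug.ker →
      (∃ v ∈ {v | R c v}, sm g v ∈ {v | R c v}) → ∀ v ∈ {v | R c v}, sm g v ∈ {v | R c v} :=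
  fun g hg => block_of_invariantRel sm R hsymm htrans g (hinv g hg) c

/-- **IUTchII:Cor2.4(i)** (kurims p.71 l.1–3) **`hlevel` at one level with `blk` DISCHARGED**: the per-level target
from `comp := {v | R c v}` for an invariant symmetric transitive `R`, the base vertex `c` (so `base` reads «the
cusp of `I_t` meets `c`'s component», i.e. `R c (cuspVtx 1)`), `inc` ([IUTchI] Cor 2.3 (vi) at level `i`) and
`stab`. PROVED. [claim: Mochizuki2012, status: disputed] -/
theorem hlevel_of_levelRel (H : Subgroup P) (I : Subgroup W.Corhat) (U : Subgroup W.Corhat)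
    {V : Type*} (sm : W.Corhat → V → V) (R : V → V → Prop) (c : V)
    (hsymm : ∀ {v w}, R v w → R w v) (htrans : ∀ {v w x}, R v w → R w x → R v x)
    (hinv : ∀ g : W.Corhat, g ∈ W.piPM ⊓ W.aug.ker → ∀ {v w}, R v w → R (sm g v) (sm g w))
    (cuspVtx : W.Corhat → V) (cuspVtx_mul : ∀ a b : W.Corhat, cuspVtx (a * b) = sm a (cuspVtx b))
    (base : R c (cuspVtx 1))
    (inc : ∀ g : W.Corhat, g ∈ W.piPM ⊓ W.aug.ker →
      I.map (MulAut.conj g).toMonoidHom ≤ W.pmBox H → R c (cuspVtx g))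
    (stab : ∀ g : W.Corhat, g ∈ W.piPM ⊓ W.aug.ker →
      (∀ v, R c v → R c (sm g v)) → ∃ k ∈ W.deltaPmBox H, k⁻¹ * g ∈ U) :
    ∀ γ' : W.Corhat, γ' ∈ W.piPM ⊓ W.aug.ker →
      I.map (MulAut.conj γ').toMonoidHom ≤ W.pmBox H → ∃ k ∈ W.deltaPmBox H, k⁻¹ * γ' ∈ U :=
  W.hlevel_of_levelData H I U sm {v | R c v} cuspVtx cuspVtx_mul base
    (fun g hg hle => inc g hg hle) (W.blk_of_invariantRel sm R c hsymm htrans hinv)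
    (fun g hg hst => stab g hg fun v hv => hst v hv)

end PlusMinusTower

end Literature.IUT.HodgeArakelov
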